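import Summits.ABC.ABC.Theses.CubicResolventAllowance
import Summits.ABC.ABC.Theorems.TwoTorsionDictionary
import Literature.NumberTheory.CubicFields.CubicFieldForms
import Literature.NumberTheory.CubicFields.MaximalCubicRings
import Literature.NumberTheory.CubicFields.DeloneFaddeevFractionField
import Literature.NumberTheory.EllipticCurves.SzpiroLocalDataProofs
import Literature.NumberTheory.EllipticCurves.SzpiroOfAbcProofs
import Literature.NumberTheory.DiophantineGeometry.MinimalDiscriminantNormProofs
import Literature.NumberTheory.DiophantineGeometry.ConductorFactorizationProofs
import HarnessLib

/-!
# Stub-ideation k=2 (RESHAPE), rev 2 — `stub_realCubic` of crux `IndexSzpiro` (stmt-ABC-22740)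

The object change `E ↦ (F, (u,v))`: `F` = the (Delone–Faddeev / index) binary cubic form of the
MAXIMAL order of the resolvent field `K`, `(u,v) ∈ ℤ² ∖ 0` an integer point; the whole class
`{E/ℚ : ψ₂ irreducible, resolvent field K}` is the ONE explicit family `curveOfForm F u v`
(`j = 256·H³/(d_K·F²)`), primitive points = twist-minimal members, `(gu, gv)` = quadratic twist by `g`.
Everything here elaborates; `sorry` only in `helper*` / `assembly*` bodies (PROPOSALS for the stub
prover). Dictionary regression: kit job j344464 (270 480 curves, 0 violations).
-/

open Polynomial NumberField WeierstrassCurve UniqueFactorizationMonoid IsDedekindDomain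
open Literature.NumberTheory.CubicFields Literature.NumberTheory.EllipticCurves

namespace Summit.ABC.ABC.Cruxes.IndexSzpiro.StubIdeas2

/-- The stub, verbatim (registered skeleton `line2-birth.lean`, `stub_realCubic`). -/
def StubRealCubic : Prop :=
  ∀ ε : ℝ, 0 < ε → ∃ C : ℝ, ∀ (W : WeierstrassCurve ℚ) [W.IsElliptic] (K : Type) [Field K] [NumberField K],
    Irreducible W.twoTorsionPolynomial.toPoly → Module.finrank ℚ K = 3 →
    (∃ θ : K, aeval θ W.twoTorsionPolynomial.toPoly = 0) → 0 < NumberField.discr K →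
    (W.minimalDiscriminantNorm ℤ : ℝ) ≤ C * |(NumberField.discr K : ℝ)| * (W.conductorNorm ℤ : ℝ) ^ (6 + ε)

/-- Verbatim mirror of `BinaryCubic.hessianEval` (`CubicFields/HessianCovariant.lean`, whose import
`SingularZeroModP` is unbuilt on the farm today): `H_F(u,v) = P u² + Q uv + R v²`. -/
def hessEval (F : BinaryCubic ℤ) (u v : ℤ) : ℤ :=
  (F.b ^ 2 - 3 * F.a * F.c) * u ^ 2 + (F.b * F.c - 9 * F.a * F.d) * u * v + (F.c ^ 2 - 3 * F.b * F.d) * v ^ 2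

/-- Verbatim mirror of `BinaryCubic.jacobianEval`: `G_F = F_u·H_v − F_v·H_u`. -/
def jacEval (F : BinaryCubic ℤ) (u v : ℤ) : ℤ :=
  (3 * F.a * u ^ 2 + 2 * F.b * u * v + F.c * v ^ 2) * ((F.b * F.c - 9 * F.a * F.d) * u + 2 * (F.c ^ 2 - 3 * F.b * F.d) * v) -
    (F.b * u ^ 2 + 2 * F.c * u * v + 3 * F.d * v ^ 2) * (2 * (F.b ^ 2 - 3 * F.a * F.c) * u + (F.b * F.c - 9 * F.a * F.d) * v)

/-- The syzygy `G² = 4H³ − 27·disc F·F²` (tree: `BinaryCubic.jacobianEval_sq`). -/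
theorem jacEval_sq (F : BinaryCubic ℤ) (u v : ℤ) :
    jacEval F u v ^ 2 = 4 * hessEval F u v ^ 3 - 27 * F.disc * F.eval u v ^ 2 := by
  simp only [jacEval, hessEval, BinaryCubic.eval, BinaryCubic.disc_eq]; ring

/-! ## T — the universal family of the class (twisted `X(2) → X(1)` over the cubic resolvent) -/

/-- `E_{F,u,v} : y² = x³ − 27·H_F(u,v)·x − 27·G_F(u,v)` (`H` Hessian, `G` Jacobian covariant). -/
def curveOfForm (F : BinaryCubic ℤ) (u v : ℤ) : WeierstrassCurve ℤ :=
  ⟨0, 0, 0, -27 * hessEval F u v, -27 * jacEval F u v⟩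

variable (F : BinaryCubic ℤ) (u v : ℤ)

theorem curveOfForm_b₂ : (curveOfForm F u v).b₂ = 0 := by
  simp only [curveOfForm, WeierstrassCurve.b₂]; ring
theorem curveOfForm_b₄ : (curveOfForm F u v).b₄ = -54 * hessEval F u v := by
  simp only [curveOfForm, WeierstrassCurve.b₄]; ring
theorem curveOfForm_b₆ : (curveOfForm F u v).b₆ = -108 * jacEval F u v := by
  simp only [curveOfForm, WeierstrassCurve.b₆]; ring
theorem curveOfForm_b₈ : (curveOfForm F u v).b₈ = -(27 * hessEval F u v) ^ 2 := by
  simp only [curveOfForm, WeierstrassCurve.b₈]; ring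
/-- `c₄ = 2⁴3⁴·H`. -/
theorem curveOfForm_c₄ : (curveOfForm F u v).c₄ = 1296 * hessEval F u v := by
  simp only [WeierstrassCurve.c₄, curveOfForm_b₂, curveOfForm_b₄]; ring
/-- `c₆ = 2⁵3⁶·G`. -/
theorem curveOfForm_c₆ : (curveOfForm F u v).c₆ = 23328 * jacEval F u v := by
  simp only [WeierstrassCurve.c₆, curveOfForm_b₂, curveOfForm_b₄, curveOfForm_b₆]; ring
/-- THE DISCRIMINANT IDENTITY `Δ(E_{F,u,v}) = 2⁴·3¹²·disc F·F(u,v)²` (the syzygy `jacobianEval_sq`). -/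
theorem curveOfForm_Δ : (curveOfForm F u v).Δ = 2 ^ 4 * 3 ^ 12 * F.disc * F.eval u v ^ 2 := by
  have h := jacEval_sq F u v
  simp only [WeierstrassCurve.Δ, curveOfForm_b₂, curveOfForm_b₄, curveOfForm_b₆, curveOfForm_b₈]
  linear_combination (-314928 : ℤ) * h

/-- `(u,v) ↦ (gu, gv)` is the quadratic twist by `g`: `(a₄, a₆) ↦ (g²a₄, g³a₆)`. -/
theorem curveOfForm_smul (g : ℤ) :
    (curveOfForm F (g * u) (g * v)).a₄ = g ^ 2 * (curveOfForm F u v).a₄ ∧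
      (curveOfForm F (g * u) (g * v)).a₆ = g ^ 3 * (curveOfForm F u v).a₆ := by
  constructor <;>
    simp only [curveOfForm, hessEval, jacEval] <;> ring

/-- `Δ ≠ 0` off the zero point for an irreducible form of non-zero discriminant. -/
theorem curveOfForm_Δ_ne_zero (hirr : F.IsIrreducible) (hd : F.disc ≠ 0) (huv : u ≠ 0 ∨ v ≠ 0) :
    (curveOfForm F u v).Δ ≠ 0 := by
  rw [curveOfForm_Δ]
  have hF : F.eval u v ≠ 0 := (BinaryCubic.isIrreducible_iff_eval_ne_zero F).mp hirr u v huv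
  exact mul_ne_zero (mul_ne_zero (by norm_num) hd) (pow_ne_zero 2 hF)

/-- The trace-zero element `η(u,v) := 3(uω + vθ) − (bu − cv)` of the Delone–Faddeev ring `R(F)`
(`Tr(x + yω + zθ) = 3x + by − cz`, `RingOfForm.trace_eq`). -/
def eta : RingOfForm F := ⟨-(F.b * u - F.c * v), 3 * u, 3 * v⟩

/-- `η³ − 3H(u,v)·η + G(u,v) = 0` in `R(F)`: the characteristic polynomial of `η` is
`X³ − 3H X + G`, so `x = −3η` is a root of `x³ − 27Hx − 27G`, the 2-division cubic of `E_{F,u,v}`;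
i.e. THE RESOLVENT FIELD OF `E_{F,u,v}` IS `Frac R(F)`. Pure coordinate algebra. -/
theorem eta_cubic : eta F u v ^ 3 - ((3 * hessEval F u v : ℤ) : RingOfForm F) * eta F u v
    + ((jacEval F u v : ℤ) : RingOfForm F) = 0 := by
  have h3 : eta F u v ^ 3 = eta F u v * eta F u v * eta F u v := by rw [pow_succ, pow_two]
  rw [h3]
  ext <;> simp only [eta, RingOfForm.mul_x, RingOfForm.mul_y, RingOfForm.mul_z, RingOfForm.add_x,
    RingOfForm.add_y, RingOfForm.add_z, RingOfForm.sub_x, RingOfForm.sub_y, RingOfForm.sub_z,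
    RingOfForm.intCast_x, RingOfForm.intCast_y, RingOfForm.intCast_z, RingOfForm.zero_x,
    RingOfForm.zero_y, RingOfForm.zero_z, hessEval, jacEval] <;> ring

/-- The 2-division cubic of `E_{F,u,v}` is `4x³ − 108H x − 108G`. -/
theorem twoTorsionPolynomial_curveOfForm :
    ((curveOfForm F u v).baseChange ℚ).twoTorsionPolynomial =
      ⟨4, 0, -108 * (hessEval F u v : ℚ), -108 * (jacEval F u v : ℚ)⟩ := by
  have h2 := curveOfForm_b₂ F u v
  have h4 := curveOfForm_b₄ F u v
  have h6 := curveOfForm_b₆ F u v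
  ext <;> simp [WeierstrassCurve.twoTorsionPolynomial, WeierstrassCurve.baseChange, h2, h4, h6] <;> ring

/-- T1 (M). CLASS PARAMETRISATION: every `E/ℚ` with irreducible `ψ₂` and resolvent field `K` is
`ℚ`-isomorphic to `E_{F,u,v}` for the index form `F` of `𝓞_K` (`e : R(F) ≃ 𝓞_K`, which exists by
`exists_ringOfForm_ringEquiv_ringOfIntegers`) and some `(u,v) ≠ 0`. Proof route: short model
`[0,0,0,A,B]`; its root `e₁ ∈ K` has trace `0`; scale (`λ ∈ 3ℤ`) so that `λ²e₁ = x + yω + zθ ∈ 𝓞_K`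
with `y = −9u`, `z = −9v`; `Tr = 3x + by − cz = 0` then gives `x = 3(bu − cv)`, i.e. `λ²e₁ = −3·η(u,v)`;
both monic cubics `X³ + λ⁴A X + λ⁶B` and `X³ − 27H X − 27G` are the minimal polynomial of `−3η`
(`eta_cubic`), hence equal, and `(u,v) ≠ 0` as `e₁ ∉ ℚ`. -/
theorem helperT1_param (W : WeierstrassCurve ℚ) [W.IsElliptic] (K : Type) [Field K] [NumberField K]
    (hirr : Irreducible W.twoTorsionPolynomial.toPoly) (hK : Module.finrank ℚ K = 3)
    (hθ : ∃ θ : K, aeval θ W.twoTorsionPolynomial.toPoly = 0)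
    (F : BinaryCubic ℤ) (e : RingOfForm F ≃+* 𝓞 K) :
    ∃ u v : ℤ, (u ≠ 0 ∨ v ≠ 0) ∧ ∃ C : VariableChange ℚ, C • W = (curveOfForm F u v).baseChange ℚ := by
  sorry

/-- T2 (S). Square scalings are isomorphisms (`(n²u, n²v)` ↔ the variable change `x ↦ n²x`), so in
the class one may take `(u,v) = g·(u₀,v₀)` with `(u₀,v₀)` coprime and `g` SQUAREFREE. -/
theorem helperT2_sq_smul (n : ℤ) (hn : n ≠ 0) :
    ∃ C : VariableChange ℚ,
      C • (curveOfForm F u v).baseChange ℚ = (curveOfForm F (n ^ 2 * u) (n ^ 2 * v)).baseChange ℚ := by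
  sorry

/-- T3 (M). PRIMITIVE POINTS OF A MAXIMAL FORM ARE TWIST-MINIMAL at `p ≥ 5`:
`¬ (p² ∣ H(u,v) ∧ p³ ∣ G(u,v))`, i.e. `¬ (p² ∣ c₄ ∧ p³ ∣ c₆)` for `E_{F,u,v}` (a fortiori Kraus-minimal).
Proof route: otherwise `η/p` has integral characteristic polynomial `X³ − 3(H/p²)X + G/p³`
(`eta_cubic`), so lies in the maximal order `= R(F)` (`ringEquivRingOfIntegers hmax`), forcing
`p ∣ 3u ∧ p ∣ 3v`. (Also true at `p = 2`; at `p = 3` one power of `3` is genuinely removable.) -/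
theorem helperT3_twistMinimal (hmax : RingOfForm.IsMaximal F) (hirr : F.IsIrreducible)
    (huv : IsCoprime u v) (p : ℕ) (hp : p.Prime) (h5 : 5 ≤ p) :
    ¬ ((p : ℤ) ^ 2 ∣ hessEval F u v ∧ (p : ℤ) ^ 3 ∣ jacEval F u v) := by
  sorry

/-- T4 (M). LOCAL DISCRIMINANT DICTIONARY at `p ≥ 5` (`(u,v)` coprime, `g` squarefree): the model
`E_{F,gu,gv}` is minimal at `p` (T3 + `isMinimalAt_of_valuation`: `v(c₄) < 4 ∨ v(c₆) < 6`), hence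
`v_p(Δ_min) = 6·v_p(g) + v_p(disc F) + 2·v_p(F(u,v))` (`curveOfForm_Δ`,
`factorization_minimalDiscriminantNorm_holds`). Regression j344464/Ta: 0 violations. -/
theorem helperT4_localDisc (hmax : RingOfForm.IsMaximal F) (hirr : F.IsIrreducible) (hd : F.disc ≠ 0)
    (huv : IsCoprime u v) (g : ℤ) (hg : Squarefree g)
    (hΔ : (curveOfForm F (g * u) (g * v)).Δ ≠ 0) (p : ℕ) (hp : p.Prime) (h5 : 5 ≤ p) :
    haveI := isElliptic_baseChange_int _ hΔ
    (((curveOfForm F (g * u) (g * v)).baseChange ℚ).minimalDiscriminantNorm ℤ).factorization p =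
      6 * g.natAbs.factorization p + F.disc.natAbs.factorization p
        + 2 * (F.eval u v).natAbs.factorization p := by
  sorry

/-- T5 (M). CONDUCTOR SUPPORT at `p ≥ 5` (B–G 12.5.9 on the `p`-minimal model, tree
`conductorExponent_ne_zero_of_dvd_Δ`, `conductorExponent_eq_one_of_dvd_Δ_of_not_dvd_c₄`,
`two_le_conductorExponent_of_dvd_Δ_of_dvd_c₄`, `conductorExponent_le_two_of_five_le_natGenerator_holds`,
`factorization_conductorNorm_holds`): `p ∣ N ↔ p ∣ g·disc F·F(u,v)`;
`p² ∣ N ↔ p ∣ g ∨ (p ∣ disc F·F(u,v) ∧ p ∣ H(u,v))`; `¬ p³ ∣ N`.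
Regression j344464 (g = 1): Tb–Te, 0 violations; observed table `[v_p d_K, f_p, v_p Δ_min]` at
`p ∣ d_K ∤ F`: only `[1,1,1]`, `[2,2,2]`; `p ∣ F ∤ d_K`: multiplicative, `n_p = 2 v_p F`. -/
theorem helperT5_conductor (hmax : RingOfForm.IsMaximal F) (hirr : F.IsIrreducible) (hd : F.disc ≠ 0)
    (huv : IsCoprime u v) (g : ℤ) (hg : Squarefree g)
    (hΔ : (curveOfForm F (g * u) (g * v)).Δ ≠ 0) (p : ℕ) (hp : p.Prime) (h5 : 5 ≤ p) :
    haveI := isElliptic_baseChange_int _ hΔ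
    (p ∣ ((curveOfForm F (g * u) (g * v)).baseChange ℚ).conductorNorm ℤ ↔
        (p : ℤ) ∣ g * F.disc * F.eval u v) ∧
      (p ^ 2 ∣ ((curveOfForm F (g * u) (g * v)).baseChange ℚ).conductorNorm ℤ ↔
        ((p : ℤ) ∣ g ∨ ((p : ℤ) ∣ F.disc * F.eval u v ∧ (p : ℤ) ∣ hessEval F u v))) ∧
      ¬ p ^ 3 ∣ ((curveOfForm F (g * u) (g * v)).baseChange ℚ).conductorNorm ℤ := by
  sorry

/-- T6 (S, in the tree up to `curveOfForm_Δ`). `Δ_min ∣ 2⁴·3¹²·disc F·F(u,v)²` for EVERY point. -/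
theorem helperT6_disc_dvd (hΔ : (curveOfForm F u v).Δ ≠ 0) :
    haveI := isElliptic_baseChange_int _ hΔ
    ((curveOfForm F u v).baseChange ℚ).minimalDiscriminantNorm ℤ ∣
      (2 ^ 4 * 3 ^ 12 * F.disc * F.eval u v ^ 2).natAbs := by
  haveI := isElliptic_baseChange_int _ hΔ
  have h := Summit.ABC.ABC.Theorems.TwoTorsionDictionary.minimalDiscriminantNorm_dvd_natAbs_Δ
    (curveOfForm F u v)
  rwa [curveOfForm_Δ] at h

/-! ## The EC-free core (index-form / Thue–Mahler face of the stub) -/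

/-- The `5`-rough conductor proxy of a point: `∏_{p ≥ 5, p ∣ disc F·F(u,v)} p^(1 + [p ∣ H_F(u,v)])`
(`= N_E` off `2, 3` for `E = E_{F,u,v}`, `(u,v)` coprime, by T5 with `g = 1`). -/
noncomputable def conductorProxy (F : BinaryCubic ℤ) (u v : ℤ) : ℕ :=
  ∏ p ∈ ((F.disc * F.eval u v).natAbs.primeFactors.filter (fun p => 5 ≤ p)),
    p ^ (if (p : ℤ) ∣ hessEval F u v then 2 else 1)

/-- CORE A (OPEN; the faithful EC-free equivalent of the stub up to constants): INDEX-FORM SZPIRO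
for totally real cubic fields — for every irreducible MAXIMAL form `F` with `disc F > 0` and every
coprime `(u,v)`: `|F(u,v)| ≤ C(ε)·conductorProxy^{3+ε}`. One form per field, no basis, no `K`. -/
def IndexFormSzpiroReal : Prop :=
  ∀ ε : ℝ, 0 < ε → ∃ C : ℝ, ∀ F : BinaryCubic ℤ, F.IsIrreducible → RingOfForm.IsMaximal F → 0 < F.disc →
    ∀ u v : ℤ, IsCoprime u v →
      |((F.eval u v : ℤ) : ℝ)| ≤ C * (conductorProxy F u v : ℝ) ^ (3 + ε)

/-- CORE A⁺ (OPEN, STRICTLY STRONGER — radical in place of the proxy, i.e. it also forgoes the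
second conductor unit at additive places; used only as the census normalisation `κ`; NOT to be
filed as an item: Szpiro(6+ε) gives CORE A but only `CORE A⁺ × rad(d_K)^{5+ε}`). -/
def IndexFormRadicalSzpiroReal : Prop :=
  ∀ ε : ℝ, 0 < ε → ∃ C : ℝ, ∀ F : BinaryCubic ℤ, F.IsIrreducible → RingOfForm.IsMaximal F → 0 < F.disc →
    ∀ u v : ℤ, IsCoprime u v →
      ((F.eval u v : ℤ) : ℝ) ^ 2 ≤ C * ((radical (F.disc * F.eval u v).natAbs : ℕ) : ℝ) ^ (6 + ε)

/-- `CORE A⁺ ⇒ CORE A` (S: `rad ≤ 6·conductorProxy`, `C ↦ √C·6^{3+ε}`). -/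
theorem helper_indexFormSzpiro_of_radical (h : IndexFormRadicalSzpiroReal) : IndexFormSzpiroReal := by
  sorry

/-- ASSEMBLY T (M/L): `CORE A → stub`. Plan: T1 (`W ≅ E_{F,gu₀,gv₀}`, `F` from
`exists_ringOfForm_ringEquiv_ringOfIntegers`, maximal by `isMaximal_of_ringEquiv_ringOfIntegers`,
irreducible by `isIrreducible_of_ringEquiv_ringOfIntegers`, `disc F = d_K` by
`disc_eq_discr_of_ringEquiv_ringOfIntegers`) → WLOG `g` squarefree (T2, invariance
`minimalDiscriminantNorm_smul_rat` / `conductorNorm_smul_rat`) → `Δ_min ≤ 2⁴3¹²·g⁶·d_K·F(u₀,v₀)²`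
(T6) → `N ≥ conductorProxy(F,u₀,v₀)·∏_{p∣g, p≥5, p∤…} p²·…` (T5) → CORE A with `ε/2`:
per prime `p ≥ 5` the exponent budget is `6[p∣g] + 2v_p(F₀) ≤ f_p·(6+ε)` globally, `2,3`: constants. -/
theorem assemblyT (h : IndexFormSzpiroReal) : StubRealCubic := by
  sorry

/-! ## W — what `closes` actually consumes (advice to the tenure planner, nothing to prove) -/

/-- The stub with free exponents: `Δ_min ≤ C·|d_K|^A·N^B` on the real `r = 0` class. -/
def StubRealCubicWith (A B : ℝ) : Prop :=
  ∃ C : ℝ, ∀ (W : WeierstrassCurve ℚ) [W.IsElliptic] (K : Type) [Field K] [NumberField K],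
    Irreducible W.twoTorsionPolynomial.toPoly → Module.finrank ℚ K = 3 →
    (∃ θ : K, aeval θ W.twoTorsionPolynomial.toPoly = 0) → 0 < NumberField.discr K →
    (W.minimalDiscriminantNorm ℤ : ℝ) ≤
      C * |(NumberField.discr K : ℝ)| ^ A * (W.conductorNorm ℤ : ℝ) ^ B

/-- POLYNOMIAL SZPIRO ON THE REAL CLASS — all that `ResolventPayoff` (`∃ K C, log Δ_min ≤ K log N + C`)
needs from this half, since `|d_K| ≤ 1944·N²` (`ResolventDiscBounds`, closed). CORE A with
`conductorProxy^{3+ε}` weakened to `|disc F|^β·conductorProxy^{B/2}` still lands here. -/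
def PolySzpiroRealClass : Prop := ∃ A B : ℝ, StubRealCubicWith A B

theorem polySzpiro_of_stub (h : StubRealCubic) : PolySzpiroRealClass := by
  obtain ⟨C, hC⟩ := h 1 one_pos
  refine ⟨1, 6 + 1, C, fun W _ K _ _ hirr hK hθ hd => ?_⟩
  simpa [Real.rpow_one] using hC W K hirr hK hθ hd

/-! ## In-Lean regression (constants of the dictionary; cf. kit job j344464) -/

/-- `F = u³ + u²v − 2uv² − v³` (the reduced index form of `ℚ(ζ₇)⁺`, `disc F = 49`). -/
example : (⟨1, 1, -2, -1⟩ : BinaryCubic ℤ).disc = 49 := by norm_num [BinaryCubic.disc_eq]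
/-- its point `(24, 5)`: `F(24,5) = 7·13³` (census row: `N = 2²·7²·13`, `Δ_min = 2⁴·49·F(24,5)²`). -/
example : (⟨1, 1, -2, -1⟩ : BinaryCubic ℤ).eval 24 5 = 7 * 13 ^ 3 := by norm_num [BinaryCubic.eval]
example : (185426694544 : ℤ) = 2 ^ 4 * 49 * (7 * 13 ^ 3) ^ 2 := by norm_num
example : (curveOfForm ⟨1, 1, -2, -1⟩ 24 5).Δ = 2 ^ 4 * 3 ^ 12 * 49 * (7 * 13 ^ 3) ^ 2 := by
  rw [curveOfForm_Δ]; norm_num [BinaryCubic.disc_eq, BinaryCubic.eval]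
/-- `7 ∣ H(24,5)` (so `f₇ = 2`: `7² ∥ N = 2548`), `13 ∤ H(24,5)` (`f₁₃ = 1`). -/
example : (7 : ℤ) ∣ hessEval ⟨1, 1, -2, -1⟩ 24 5 ∧ ¬ (13 : ℤ) ∣ hessEval ⟨1, 1, -2, -1⟩ 24 5 := by
  norm_num [hessEval]

end Summit.ABC.ABC.Cruxes.IndexSzpiro.StubIdeas2
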